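import Summits.ResolutionOfSingularities.ResolutionOfSingularities.Theorems.FrobeniusClosingPatchingRelPerfectDepthPhaseCLetterLaws
import HarnessLib

/-!
# Crux `PatchingRelPerfect` (stmt-ResolutionOfSingularities-16161), chain W5.2 — F7(β) (β-AX) PHASE C:
# the MOVE LAWS of the UNIAXIAL class (idea-1 LT-2, the (α_m) / N3-pocket shapes) — curve centre `V(g, t, u)`

[OURS · L1 W5.2 · F7(β) (β-AX) X3 `PhaseCTermination₂` · res-L1-w52-idea-1 X3 MEASURE MEMO inst. 1 §4 LT-2 «uniaxial contact: K̄ = (M·uᵐ, M_N),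
curve `W = V(u, t)`, chart `u` — the new member IS `u`; chart `t` — the shape recurs with `n ↦ n − 1`»] res-L1-w52-stub-1 g5.  Replaces the role of
NO printed item; NOT a statement of the manuscript under review (AI-written, weaker than expert review).  Ring level, ANY commutative ring, ALL
exponents symbolic; companion of `…DepthPhaseCLetterLaws` (poleCons / Π_t / Π_m / axis / line with `m ∣ μ`) and `…DepthPhaseCContactLaws`.

The uniaxial germ (bare host `V(g)`, second host `V(g + tᵃ uᵐ c)`, `N`-summand `tᵇ d`; `t` a member, `u` a NON-member regular parameter,
`c, d` the remaining member letters):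

  `K = (g) + (g + tᵃ uᵐ c) + (tᵇ d)`,   centre the curve `V(g, t, u)` (legal for `a + m ≥ 1` and `b ≥ 1`).

* `uniaxial_uChart` (`g = u g′`, `t = u t′`): `K = (u) · ((g′) + (g′ + u^{a+m−1} t′ᵃ c) + (u^{b−1} t′ᵇ d))` — the new exceptional `u` is a MEMBER,
  the host contact `uᵐ` has become member mass (idea-1: «ρ ↦ 0, all mass is member mass»);
* `uniaxial_tChart` (`g = t g′`, `u = t u′`): `K = (t) · ((g′) + (g′ + t^{a+m−1} u′ᵐ c) + (t^{b−1} d))` — the SAME shape with `b ↦ b − 1`,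
  `a ↦ a + m − 1` (idea-1: «the shape recurs with n ↦ n − 1»);
* `uniaxial_gChart`: the germ is `(g)`;
* Rees-chart images for the centre `(g, t, u)` (`map_uniaxial_two`, `map_uniaxial_one`, `map_uniaxial_zero`).

Fact-free; design evidence / citation material for X3 (LT-2) and the TailRuns; END tests and the measure are the memo's.

## References
* The Stacks Project, Tags 0804, 0BIQ (affine blow-up algebras and their charts). [StacksProject]
* J. Kollár, *Lectures on Resolution of Singularities* (2007), (3.111) Step 3 (monomial bookkeeping). [Kollar2007]
-/

-- `Summit.<Summit>.<Sub>.Theorems` with `Sub = Summit` (single-conjunct summit, D-0017)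
set_option linter.dupNamespace false

noncomputable section

open Literature.AlgebraicGeometry.Resolution

namespace Summit.ResolutionOfSingularities.ResolutionOfSingularities.Theorems

universe u

namespace DepthPhaseC

/-- The letter-class germ `K = (g) + (g + φ) + (n)` (as in `…DepthPhaseCLetterLaws`). -/
local notation3 "Kl[" g "," φ "," n "]" => (Ideal.span {g} ⊔ Ideal.span {g + φ} ⊔ Ideal.span {n})

section Algebra

variable {A : Type u} [CommRing A]

/-- **Uniaxial move, `u`-chart** (`g = u g′`, `t = u t′`; `a + m ≥ 1`, `b ≥ 1`): the new exceptional `u` carries `a + m − 1` on the host side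
and `b − 1` on the `N`-side; `t′` keeps `a`, `b`. [folklore] -/
theorem uniaxial_uChart (g' t' u c d : A) {a m b : ℕ} (ham : 1 ≤ a + m) (hb : 1 ≤ b) :
    Kl[u * g', (u * t') ^ a * u ^ m * c, (u * t') ^ b * d] =
      Ideal.span {u} * Kl[g', u ^ (a + m - 1) * t' ^ a * c, u ^ (b - 1) * t' ^ b * d] := by
  obtain ⟨k, hk⟩ := Nat.exists_eq_add_of_le ham
  obtain ⟨l, rfl⟩ := Nat.exists_eq_add_of_le hb
  rw [hk, Nat.add_sub_cancel_left, Nat.add_sub_cancel_left,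
    show (u * t') ^ a * u ^ m * c = u * (u ^ k * t' ^ a * c) by
      rw [mul_pow, show u ^ a * t' ^ a * u ^ m * c = u ^ (a + m) * (t' ^ a * c) by ring, hk]; ring,
    show (u * t') ^ (1 + l) * d = u * (u ^ l * t' ^ (1 + l) * d) by ring, germ_factor]

/-- **Uniaxial move, `t`-chart** (`g = t g′`, `u = t u′`; `a + m ≥ 1`, `b ≥ 1`): the SAME shape with `(a, b) ↦ (a + m − 1, b − 1)` and `u′ᵐ`
kept — the recursion of LT-2. [folklore] -/
theorem uniaxial_tChart (g' t u' c d : A) {a m b : ℕ} (ham : 1 ≤ a + m) (hb : 1 ≤ b) :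
    Kl[t * g', t ^ a * (t * u') ^ m * c, t ^ b * d] =
      Ideal.span {t} * Kl[g', t ^ (a + m - 1) * u' ^ m * c, t ^ (b - 1) * d] := by
  obtain ⟨k, hk⟩ := Nat.exists_eq_add_of_le ham
  obtain ⟨l, rfl⟩ := Nat.exists_eq_add_of_le hb
  rw [hk, Nat.add_sub_cancel_left, Nat.add_sub_cancel_left,
    show t ^ a * (t * u') ^ m * c = t * (t ^ k * u' ^ m * c) by
      rw [mul_pow, show t ^ a * (t ^ m * u' ^ m) * c = t ^ (a + m) * (u' ^ m * c) by ring, hk]; ring,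
    show t ^ (1 + l) * d = t * (t ^ l * d) by ring, germ_factor]

/-- **Uniaxial move, `g`-chart** (`t = g t′`, `u = g u′`; `a + m ≥ 1`, `b ≥ 1`): the germ is `(g)`. [folklore] -/
theorem uniaxial_gChart (g t' u' c d : A) {a m b : ℕ} (ham : 1 ≤ a + m) (hb : 1 ≤ b) :
    Kl[g, (g * t') ^ a * (g * u') ^ m * c, (g * t') ^ b * d] = Ideal.span {g} := by
  obtain ⟨k, hk⟩ := Nat.exists_eq_add_of_le ham
  obtain ⟨l, rfl⟩ := Nat.exists_eq_add_of_le hb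
  rw [show (g * t') ^ a * (g * u') ^ m * c = g * (g ^ k * t' ^ a * u' ^ m * c) by
      rw [mul_pow, mul_pow, show g ^ a * t' ^ a * (g ^ m * u' ^ m) * c = g ^ (a + m) * (t' ^ a * u' ^ m * c) by ring, hk]
      ring,
    show (g * t') ^ (1 + l) * d = g * (g ^ l * t' ^ (1 + l) * d) by ring, germ_eq_span_of_dvd]

/-- **After the `u`-chart the host contact is member mass**: `(g′) + (g′ + M) + (n) = (g′) + (M) + (n)` with `M` a monomial in members —
a monomial-sum presentation in the chart letters (idea-1: ρ ↦ 0). [folklore] -/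
theorem uniaxial_uChart_monomial (g' M n : A) : Kl[g', M, n] = Ideal.span {g'} ⊔ Ideal.span {M} ⊔ Ideal.span {n} :=
  germ_eq g' M n

end Algebra

/-! ## Rees-chart packaging for the centre `(g, t, u)` -/

section Charts

variable {R : Type u} [CommRing R] (g t u c d : R)

local notation3 "c₃" => (![g, t, u] : Fin 3 → R)

set_option maxHeartbeats 400000 in
-- instance-path defeq through `HomogeneousLocalization`'s standalone `Pow`/`Mul` (as in p508825)
/-- **Uniaxial move, `u`-chart image**. [cite: StacksProject, Tag 0804] -/
theorem map_uniaxial_two {a m b : ℕ} (ham : 1 ≤ a + m) (hb : 1 ≤ b) :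
    (Kl[g, t ^ a * u ^ m * c, t ^ b * d]).map (chartBase c₃ 2) = Ideal.span {chartBase c₃ 2 u} *
      Kl[chartGen c₃ 2 0, chartBase c₃ 2 u ^ (a + m - 1) * chartGen c₃ 2 1 ^ a * chartBase c₃ 2 c,
        chartBase c₃ 2 u ^ (b - 1) * chartGen c₃ 2 1 ^ b * chartBase c₃ 2 d] := by
  have cbg : chartBase c₃ 2 g = chartBase c₃ 2 u * chartGen c₃ 2 0 := reesChartBase_apply_eq_mul_chartGen c₃ 2 0
  have cbt : chartBase c₃ 2 t = chartBase c₃ 2 u * chartGen c₃ 2 1 := reesChartBase_apply_eq_mul_chartGen c₃ 2 1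
  rw [map_sup₃, map_add, map_mul, map_mul, map_mul, map_pow, map_pow, map_pow, cbg, cbt]
  exact uniaxial_uChart _ _ _ _ _ ham hb

set_option maxHeartbeats 400000 in
-- instance-path defeq through `HomogeneousLocalization`'s standalone `Pow`/`Mul` (as in p508825)
/-- **Uniaxial move, `t`-chart image** — the recursion. [cite: StacksProject, Tag 0804] -/
theorem map_uniaxial_one {a m b : ℕ} (ham : 1 ≤ a + m) (hb : 1 ≤ b) :
    (Kl[g, t ^ a * u ^ m * c, t ^ b * d]).map (chartBase c₃ 1) = Ideal.span {chartBase c₃ 1 t} *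
      Kl[chartGen c₃ 1 0, chartBase c₃ 1 t ^ (a + m - 1) * chartGen c₃ 1 2 ^ m * chartBase c₃ 1 c,
        chartBase c₃ 1 t ^ (b - 1) * chartBase c₃ 1 d] := by
  have cbg : chartBase c₃ 1 g = chartBase c₃ 1 t * chartGen c₃ 1 0 := reesChartBase_apply_eq_mul_chartGen c₃ 1 0
  have cbu : chartBase c₃ 1 u = chartBase c₃ 1 t * chartGen c₃ 1 2 := reesChartBase_apply_eq_mul_chartGen c₃ 1 2
  rw [map_sup₃, map_add, map_mul, map_mul, map_mul, map_pow, map_pow, map_pow, cbg, cbu]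
  exact uniaxial_tChart _ _ _ _ _ ham hb

set_option maxHeartbeats 400000 in
-- instance-path defeq through `HomogeneousLocalization`'s standalone `Pow`/`Mul` (as in p508825)
/-- **Uniaxial move, `g`-chart image**: `(g)`. [cite: StacksProject, Tag 0804] -/
theorem map_uniaxial_zero {a m b : ℕ} (ham : 1 ≤ a + m) (hb : 1 ≤ b) :
    (Kl[g, t ^ a * u ^ m * c, t ^ b * d]).map (chartBase c₃ 0) = Ideal.span {chartBase c₃ 0 g} := by
  have cbt : chartBase c₃ 0 t = chartBase c₃ 0 g * chartGen c₃ 0 1 := reesChartBase_apply_eq_mul_chartGen c₃ 0 1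
  have cbu : chartBase c₃ 0 u = chartBase c₃ 0 g * chartGen c₃ 0 2 := reesChartBase_apply_eq_mul_chartGen c₃ 0 2
  rw [map_sup₃, map_add, map_mul, map_mul, map_mul, map_pow, map_pow, map_pow, cbt, cbu]
  exact uniaxial_gChart _ _ _ _ _ ham hb

end Charts

end DepthPhaseC

end Summit.ResolutionOfSingularities.ResolutionOfSingularities.Theorems

end
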